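import Summits.QuantumAdvantage.QuantumAdvantage.Theorems.CubicForrelationNearExactIsExactTwelveLevelSixBothGe930
import Summits.QuantumAdvantage.QuantumAdvantage.Theorems.CubicForrelationNearExactIsExactTwelveTypeO930Dead
import Summits.QuantumAdvantage.QuantumAdvantage.Theorems.CubicForrelationNearExactIsExactTwelveClosed932

/-!
# Crux `CubicForrelation.NearExactIsExact` (stmt-QuantumAdvantage-14043) — n = 12: the rung `465/512 = 930/1024` is CLOSED; `θ₁₂ ≤ 930/1024 − 2⁻¹⁴`

Certificate seat `b2b-cforr-cert` (gen 20).  HONEST FRAMING: a DECIDABLE VERDICT (kernel-checked, standard axioms, no `decide`) on the finite ladder at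
`n = 12`: the value `930/1024` is NOT attained — no cubic pair on 12 bits has `930/1024 ≤ Φ < 1` — so with the value granularity `Φ ∈ 2⁻¹⁴ℤ`
(`stub_valueGranularity`) `θ₁₂ ∈ [57/64, 14879/16384]`, `14879/16384 = 930/1024 − 1/16384`; the 17 values `913/1024, …, 929/1024` (and the grid
points `k/16384`, `14593 ≤ k ≤ 14879`) remain undecided.  NOT summit progress (the crux asks for ONE `θ < 1` uniform in `n`).

Assembly (`tw20_window_ge930_false`): by Ax each side is at level `≥ 4`; a type-O side is dead (`to20_typeO_ge930_false`, …TwelveTypeO930Dead: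
the zero-excess base-`992` partner identity makes the partner a level-5 side), a level-5 side is dead (`tw20_levelFive_ge930_false`,
…TwelveLevelFive930Dead: straddling 5-flats + granularity of the hyperplane character sums + the type-O zero-excess theorem), and a level-`≥ 6` ×
level-`≥ 6` pair is dead (`tw20_levelSix_both_ge930_false`, …TwelveLevelSixBothGe930: off-flat trichotomy at energy `≤ 240` with the weight
budget, ℓ¹ engine at `B = 752`).

* `tw20_window_ge930_false` / `isolation_twelve_ge_930`: `Φ ≥ 930/1024 ⇒ Φ = 1` for cubic pairs on 12 bits.
* `tw20_gt_14879_eq_one` / `isolation_twelve_gt_14879`: `Φ > 14879/16384 ⇒ Φ = 1`.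
* `theta_twelve_lt_930`: `θ₁₂ ∈ [57/64, 14879/16384]`.
* `no_window_twelve_ge_930`: no cubic pair on 12 bits has `930/1024 ≤ Φ < 1`.

References: Ax (1964) / McEliece (1972); Kasami–Tokura (1970) (through the tree's own `kt3_weights_all`); MacWilliams–Sloane (1977) Ch. 13–15.
Everything below is proved from Mathlib and the tree; axioms are the standard three.
-/

set_option linter.dupNamespace false -- D-0017: single-problem summit ⇒ `QuantumAdvantage.QuantumAdvantage` by design

noncomputable section

namespace Summit.QuantumAdvantage.QuantumAdvantage.Theorems.CubicForrelation.NearExactIsExact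

open Finset
open Literature.Computability.QuantumComplexity
open Literature.Computability.QuantumComplexity.DerivativeWalsh (W)

/-- **One side at level `≥ 6` at `Φ ≥ 930/1024`**: for a cubic pair on 12 bits with `Φ(f,g) ≥ 930/1024`, `W_g ∈ 64ℤ` (type O and level 5 are
dead). [this work] -/
theorem tw20_ge930_levelSix (f g : (Fin (6 + 6) → Bool) → Bool) (hf : IsDegLeFun 3 f) (hg : IsDegLeFun 3 g)
    (hlo : (930 / 1024 : ℝ) ≤ forrelation f g) :
    ∃ w : (Fin (6 + 6) → Bool) → ℤ, ∀ x, W (fun y => signOf (g y)) x = (2 : ℝ) ^ 6 * (w x : ℝ) := by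
  obtain ⟨ub, hub⟩ := tw_base (n := 6 + 6) g hg 4 (by norm_num)
  have hO : ∀ x, ¬ Odd (ub x) := fun x hx => to20_typeO_ge930_false f g hf hg ub hub ⟨x, hx⟩ hlo
  have hub5 := tw_level_up (j := 4) g ub hub hO
  have h5 : ∀ x, ¬ Odd (ub x / 2) := fun x hx => tw20_levelFive_ge930_false f g hf hg (fun x => ub x / 2) hub5 ⟨x, hx⟩ hlo
  exact ⟨fun x => ub x / 2 / 2, tw_level_up (j := 5) g (fun x => ub x / 2) hub5 h5⟩

/-- **The window `[930/1024, 1)` is EMPTY at `n = 12`**: cubic `f, g` on `6 + 6` bits with `930/1024 ≤ Φ(f,g) < 1` do not exist.  Finite-slice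
statement, NOT summit progress. [this work] -/
theorem tw20_window_ge930_false (f g : (Fin (6 + 6) → Bool) → Bool) (hf : IsDegLeFun 3 f) (hg : IsDegLeFun 3 g)
    (hlo : (930 / 1024 : ℝ) ≤ forrelation f g) (hhi : forrelation f g < 1) : False := by
  have hΦ' : forrelation g f = forrelation f g := by
    rw [Summit.QuantumAdvantage.QuantumAdvantage.Theorems.SignedCubicForrelationNotPrBPP.Negative.HalfQuad.forrelation_comm]
  obtain ⟨u'', hu''⟩ := tw20_ge930_levelSix f g hf hg hlo
  obtain ⟨w, hw⟩ := tw20_ge930_levelSix g f hg hf (by rw [hΦ']; exact hlo)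
  exact tw20_levelSix_both_ge930_false f g hf hg u'' hu'' w hw hlo hhi

/-- **`Φ ≥ 930/1024 ⇒ Φ = 1`** for cubic pairs on 12 bits.  NOT summit progress. [this work] -/
theorem tw20_ge930_eq_one (f g : (Fin 12 → Bool) → Bool) (hf : IsDegLeFun 3 f) (hg : IsDegLeFun 3 g)
    (hΦ : (930 / 1024 : ℝ) ≤ forrelation f g) : forrelation f g = 1 := by
  have hle : forrelation f g ≤ 1 := (abs_le.1 (SgnForrMem.abs_forrelation_le_one f g)).2
  rcases hle.lt_or_eq with hlt | heq
  · exact (tw20_window_ge930_false f g hf hg hΦ hlt).elim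
  · exact heq

/-- **Isolation from `930/1024` on** (packaging): the rung `930/1024` is closed. [this work] -/
theorem isolation_twelve_ge_930 : ∀ f g : (Fin 12 → Bool) → Bool, IsDegLeFun 3 f → IsDegLeFun 3 g →
    (930 / 1024 : ℝ) ≤ forrelation f g → forrelation f g = 1 :=
  fun f g hf hg h => tw20_ge930_eq_one f g hf hg h

/-- **`Φ > 14879/16384 ⇒ Φ = 1`** for cubic pairs on 12 bits: `2¹⁴Φ ∈ ℤ` (`stub_valueGranularity`), so `Φ > 930/1024 − 2⁻¹⁴` forces
`Φ ≥ 930/1024`. [this work] -/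
theorem tw20_gt_14879_eq_one (f g : (Fin 12 → Bool) → Bool) (hf : IsDegLeFun 3 f) (hg : IsDegLeFun 3 g)
    (hΦ : (14879 / 16384 : ℝ) < forrelation f g) : forrelation f g = 1 := by
  obtain ⟨z, hz⟩ := stub_valueGranularity stub_axParity 6 f g hg
  norm_num at hz
  have hΦz : forrelation f g = (z : ℝ) / 16384 := by linarith
  have hzr : (14879 : ℝ) < (z : ℝ) := by rw [hΦz] at hΦ; linarith
  have hzi : (14879 : ℤ) < z := by exact_mod_cast hzr
  have hzi' : (14880 : ℤ) ≤ z := by omega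
  have hzr' : (14880 : ℝ) ≤ (z : ℝ) := by exact_mod_cast hzi'
  exact tw20_ge930_eq_one f g hf hg (by rw [hΦz]; linarith)

/-- **Isolation above `14879/16384`** on 12 bits (packaging). [this work] -/
theorem isolation_twelve_gt_14879 : ∀ f g : (Fin 12 → Bool) → Bool, IsDegLeFun 3 f → IsDegLeFun 3 g →
    (14879 / 16384 : ℝ) < forrelation f g → forrelation f g = 1 :=
  fun f g hf hg h => tw20_gt_14879_eq_one f g hf hg h

/-- **`θ₁₂ ≤ 930/1024 − 2⁻¹⁴`**, i.e. `θ₁₂ ∈ [57/64, 14879/16384]`: the least isolation threshold for cubic pairs on 12 bits is at least the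
record `57/64` (`theta_twelve_bounds`) and at most `14879/16384` (`isolation_twelve_gt_14879`).  The value `465/512 = 930/1024` is NOT attained.
Finite-slice verdict, NOT summit progress. [this work] -/
theorem theta_twelve_lt_930 : ∃ θ₀ : ℝ, 57 / 64 ≤ θ₀ ∧ θ₀ ≤ 14879 / 16384 ∧
    IsLeast {θ : ℝ | ∀ f g : (Fin 12 → Bool) → Bool, IsDegLeFun 3 f → IsDegLeFun 3 g →
      θ < forrelation f g → forrelation f g = 1} θ₀ := by
  obtain ⟨θ₀, hθ₀⟩ := theta_exists 12
  exact ⟨θ₀, theta_twelve_bounds.2 θ₀ hθ₀.1, hθ₀.2 isolation_twelve_gt_14879, hθ₀⟩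

/-- **No cubic pair on 12 bits has `930/1024 ≤ Φ < 1`.** [this work] -/
theorem no_window_twelve_ge_930 : ¬ ∃ f g : (Fin 12 → Bool) → Bool, IsDegLeFun 3 f ∧ IsDegLeFun 3 g ∧
    (930 / 1024 : ℝ) ≤ forrelation f g ∧ forrelation f g < 1 := by
  rintro ⟨f, g, hf, hg, hlo, hhi⟩
  have h := tw20_ge930_eq_one f g hf hg hlo
  rw [h] at hhi
  exact lt_irrefl _ hhi

end Summit.QuantumAdvantage.QuantumAdvantage.Theorems.CubicForrelation.NearExactIsExact

end
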